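import Summits.CriticalPhenomena.CardyFormulaZ2.Theorems.CardyComplexConeEdgePrecompactUFRSCanonicalTurning
import Summits.CriticalPhenomena.CardyFormulaZ2.Theorems.CardyComplexConeEdgePrecompactCollarAgreement
import Summits.CriticalPhenomena.CardyFormulaZ2.Theorems.CardyComplexConeEdgePrecompactPassageAgree


/-!
# Tools for the lasso identity of the START pair: depth, heights, lattice distances
(line `qkz-strip-boundary-arm` of crux `CardyComplexCone.EdgePrecompact`, stmt-CriticalPhenomena-11387;
metric-to-lattice tools for the START-pair residual of `ufrs_initialContactCase_certJ` /
`ufrs_slippedReturnCase_certJ`)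

* `ufrs_innerFace_of_deep_ST` (registered): faces of an admissible datum at distance `≥ 2η'` from the
  complement of the Jordan domain are inner, once the mesh is small (the bulk lemma
  `exists_forall_mem_meshDomain_and_reachable`); hence the corners of an exterior closing path
  (`ufrs_exteriorClosing_ST`) are within `2η'` of the boundary;
* `exists_cposRow_le_ST`: the medial rows `(cpos c).2` of the inner corners are bounded above;
* `latticeDist_of_dist_ST`, `cpos_near_ST`, `lf_near_ST`, `corner_near_cFace_ST`: conversions between
  distances of mesh points and sup-distances of medial coordinates.

References: S. Smirnov, Ann. of Math. 172 (2010), §4; D. Chelkak, S. Smirnov, Invent. Math. 189 (2012), §1.2.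
(buildfix 2026-08-20: comment-only re-land to re-enqueue the module build after its blocking imports were repaired; no declaration changed.)
(buildfix 2026-08-20, 09:4xZ: re-enqueue — the 05:1x/05:2x lake attempt ran while the imports were mid-repair (rc 76 / false-green, never re-queued); the closure is rebuilt and green now; no declaration changed.)
-/

namespace Summit.CriticalPhenomena.CardyFormulaZ2.Cruxes.EdgePrecompact.QkzStripBoundaryArm

open MeasureTheory Filter Set Metric
open scoped Topology BigOperators Pointwise
open Literature.Probability.LatticeModels Literature.Probability.Percolation
open Literature.Probability.LatticeModels.MedialTrail
open Literature.Probability.RandomPlanarGeometry (DobrushinDomain)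
open Summit.CriticalPhenomena.CardyFormulaZ2.Theses.CardyComplexCone

noncomputable section

/-! ## Deep faces are inner -/

/-- **Deep faces are inner** (registered helper `ufrs_innerFace_of_deep_ST` of stmt-CriticalPhenomena-11387).
For `η' > 0` there is `δ₀ > 0` such that for every admissible datum `E` of the Jordan domain `D` with mesh
`E.δ < δ₀`, every face whose mesh point is at distance `≥ 2η'` from `Dᶜ` is an inner face of `E`. -/
theorem ufrs_innerFace_of_deep_ST : ∀ (D : DobrushinDomain) (η' : ℝ), 0 < η' → ∃ δ₀ > (0:ℝ), ∀ E : DiscreteDobrushin, E.Ω = D.carrier → E.IsZdAdmissible → E.δ < δ₀ → ∀ f : Site 2, 2 * η' ≤ infDist (meshPoint E.δ f) D.carrierᶜ → E.IsInnerFace f := by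
  intro D η' hη'
  set Ω := D.carrier with hΩdef
  obtain ⟨hK, hKΩ⟩ := isCompact_le_infDist_compl D.isOpen D.isBounded hη'
  obtain ⟨δ₁, hδ₁, hbulk⟩ := D.toJordanDomain.exists_forall_mem_meshDomain_and_reachable hK hKΩ
  refine ⟨min δ₁ (η' / 32), lt_min hδ₁ (by positivity), ?_⟩
  intro E hEΩ hE hEδ f hf
  have hδ : 0 < E.δ := hE.delta_pos
  have hδ₁' : E.δ < δ₁ := lt_of_lt_of_le hEδ (min_le_left _ _)
  have hδη : E.δ < η' / 32 := lt_of_lt_of_le hEδ (min_le_right _ _)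
  have hmem : ∀ u : Site 2, η' ≤ infDist (meshPoint E.δ u) Ωᶜ → u ∈ meshDomain Ω E.δ :=
    fun u hu => (hbulk E.δ hδ hδ₁').1 u hu
  -- every lattice edge at a site within `η'/2` of the `2η'`-deep point `E.δ f` is an edge of the discrete domain
  have hdeep : ∀ u v : Site 2, dist (meshPoint E.δ u) (meshPoint E.δ f) < η' / 2 →
      (zdGraph 2).Adj u v → (discreteDomainGraph E.Ω E.δ).Adj u v := by
    intro u v hu huv
    obtain ⟨k, rfl⟩ := exists_eq_add_cornerUnit huv
    have hv : dist (meshPoint E.δ (u + cornerUnit k)) (meshPoint E.δ u) ≤ 4 * E.δ :=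
      dist_meshPoint_add_cornerUnit_le hδ.le u k
    have hdeepu : ∀ p : ℂ, dist p (meshPoint E.δ u) ≤ 4 * E.δ → η' ≤ infDist p Ωᶜ := by
      intro p hp
      have h1 := infDist_le_infDist_add_dist (x := meshPoint E.δ f) (y := p) (s := Ωᶜ)
      have h2 := dist_triangle (meshPoint E.δ f) (meshPoint E.δ u) p
      rw [dist_comm] at hu
      rw [dist_comm] at hp
      rw [hΩdef] at h1; rw [hΩdef]
      linarith
    rw [hEΩ, discreteDomainGraph_adj_iff, meshGraph_adj_iff]
    refine ⟨⟨huv, ?_⟩, hmem u (hdeepu _ (by simp; positivity)), hmem _ (hdeepu _ hv)⟩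
    refine ((convex_closedBall (meshPoint E.δ u) (4 * E.δ)).segment_subset
      (mem_closedBall_self (by positivity)) (mem_closedBall.2 hv)).trans fun p hp => ?_
    exact subset_closure (hKΩ (hdeepu p (mem_closedBall.1 hp)))
  exact isInnerFace_of_deep hdeep hδ.le (by rw [dist_self]; linarith)

/-! ## Heights of inner corners -/

/-- The medial rows of the inner corners of a datum with bounded domain are bounded above. -/
theorem exists_cposRow_le_ST {E : DiscreteDobrushin} (hΩ : Bornology.IsBounded E.Ω) (hδ : 0 < E.δ) :
    ∃ Y : ℤ, ∀ c : Site 2 × Fin 4, E.IsInnerFace (cFace c) → (cpos c).2 ≤ Y := by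
  have hfin : {f : Site 2 | E.IsInnerFace f}.Finite := finite_hasAllSides hΩ hδ
  obtain ⟨Y, hY⟩ := (hfin.image fun f => f 1 - f 0).bddAbove
  refine ⟨Y + 2, fun c hc => ?_⟩
  have h1 : (cFace c) 1 - (cFace c) 0 ≤ Y := hY ⟨cFace c, hc, rfl⟩
  have h2 := isCorner_faceAt c.1 c.2
  have e : faceAt c.1 c.2 = cFace c := rfl
  rw [e] at h2
  have h3 : ∀ j : Fin 2, c.1 j = cFace c j ∨ c.1 j = cFace c j + 1 := h2
  obtain ⟨u, k⟩ := c
  simp only [cpos] at *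
  rcases h3 0 with h0 | h0 <;> rcases h3 1 with h1' | h1' <;> fin_cases k <;> simp [cposOff] <;> omega

/-! ## Lattice distances from distances of mesh points -/

/-- A lower bound on the distance of two mesh points bounds the `ℓ¹` lattice distance from below. -/
theorem latticeDist_of_dist_ST {δ : ℝ} (hδ : 0 < δ) (u c : Site 2) :
    dist (meshPoint δ u) (meshPoint δ c) ≤ δ * (|((u 0 - c 0 : ℤ) : ℝ)| + |((u 1 - c 1 : ℤ) : ℝ)|) := by
  rw [Complex.dist_eq]
  refine (Complex.norm_le_abs_re_add_abs_im _).trans ?_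
  rw [Complex.sub_re, Complex.sub_im, meshPoint_re, meshPoint_re, meshPoint_im, meshPoint_im, ← mul_sub, ← mul_sub,
    abs_mul, abs_mul, abs_of_pos hδ]
  push_cast
  ring_nf
  rfl

/-- The medial coordinates of a corner are within `1` of `(u₀ + u₁, u₁ - u₀)`, `u` its vertex. -/
theorem cpos_near_ST (c : Site 2 × Fin 4) :
    |(cpos c).1 - (c.1 0 + c.1 1)| ≤ 1 ∧ |(cpos c).2 - (c.1 1 - c.1 0)| ≤ 1 := by
  obtain ⟨u, k⟩ := c
  simp only [cpos]
  fin_cases k <;> simp [cposOff]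

/-- The left face of a unit dart is within `1` of its tail in each coordinate. -/
theorem lf_near_ST (d : Pt × Pt) : |(lf d).1 - d.1.1| ≤ 1 ∧ |(lf d).2 - d.1.2| ≤ 1 := by
  unfold lf; split_ifs <;> simp only <;> constructor <;> rw [abs_le] <;> constructor <;> omega

/-- The vertex of a corner is within `1` of the face of the corner in each coordinate. -/
theorem corner_near_cFace_ST (c : Site 2 × Fin 4) : |c.1 0 - cFace c 0| ≤ 1 ∧ |c.1 1 - cFace c 1| ≤ 1 := by
  have h2 : IsCorner c.1 (cFace c) := isCorner_faceAt c.1 c.2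
  have h3 : ∀ j : Fin 2, c.1 j = cFace c j ∨ c.1 j = cFace c j + 1 := h2
  rcases h3 0 with h0 | h0 <;> rcases h3 1 with h1 | h1 <;> constructor <;> rw [abs_le] <;> constructor <;> omega

/-- **Far corners have far medial coordinates.** If the vertex of the corner `c` and the face of the
corner `c'` have mesh points at distance `≥ δ · r`, then the left face of the dart of `c` and the medial
coordinates of `c'` are at sup-distance `≥ r - 6`. -/
theorem medial_far_ST {δ r : ℝ} (hδ : 0 < δ) (β : BondConfig (Site 2)) (c c' : Site 2 × Fin 4)
    (h : δ * r ≤ dist (meshPoint δ c.1) (meshPoint δ (cFace c'))) (m : ℤ) (hm : (m : ℝ) ≤ r - 6) :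
    m ≤ |(lf (cornerDart c)).1 - (cpos c').1| ∨ m ≤ |(lf (cornerDart c)).2 - (cpos c').2| := by
  have h1 := latticeDist_of_dist_ST hδ c.1 (cFace c')
  have h2 : r ≤ |((c.1 0 - cFace c' 0 : ℤ) : ℝ)| + |((c.1 1 - cFace c' 1 : ℤ) : ℝ)| := by
    by_contra hlt; push Not at hlt; nlinarith
  have h3 : r - 6 < ((|c.1 0 - cFace c' 0| + |c.1 1 - cFace c' 1| - 5 : ℤ) : ℝ) := by
    push_cast
    have e0 : (|((c.1 0 - cFace c' 0 : ℤ) : ℝ)|) = ((|c.1 0 - cFace c' 0| : ℤ) : ℝ) := by push_cast; rfl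
    have e1 : (|((c.1 1 - cFace c' 1 : ℤ) : ℝ)|) = ((|c.1 1 - cFace c' 1| : ℤ) : ℝ) := by push_cast; rfl
    rw [e0, e1] at h2; push_cast at h2; linarith
  have h4 : m ≤ |c.1 0 - cFace c' 0| + |c.1 1 - cFace c' 1| - 6 := by
    have : (m : ℝ) < ((|c.1 0 - cFace c' 0| + |c.1 1 - cFace c' 1| - 5 : ℤ) : ℝ) := lt_of_le_of_lt hm h3
    have := Int.cast_lt.1 this; omega
  obtain ⟨p1, p2⟩ := cpos_near_ST c
  obtain ⟨q1, q2⟩ := cpos_near_ST c'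
  obtain ⟨l1, l2⟩ := lf_near_ST (cornerDart c)
  obtain ⟨n1, n2⟩ := corner_near_cFace_ST c'
  rw [cornerDart_eq β c] at l1 l2
  simp only at l1 l2
  rw [abs_le] at p1 p2 q1 q2 l1 l2 n1 n2
  rcases le_or_gt m |(lf (cornerDart c)).1 - (cpos c').1| with hc | hc
  · exact Or.inl hc
  · right
    rw [cornerDart_eq β c] at hc ⊢
    rw [abs_lt] at hc
    rw [le_abs]
    rcases abs_cases (c.1 0 - cFace c' 0) with ⟨e0, _⟩ | ⟨e0, _⟩ <;>
      rcases abs_cases (c.1 1 - cFace c' 1) with ⟨e1, _⟩ | ⟨e1, _⟩ <;> omega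

end

end Summit.CriticalPhenomena.CardyFormulaZ2.Cruxes.EdgePrecompact.QkzStripBoundaryArm
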